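import Mathlib.MeasureTheory.Integral.Bochner.Basic
import Mathlib.Analysis.SpecialFunctions.Integrals.Basic
import Mathlib.Analysis.SpecialFunctions.Trigonometric.DerivHyp
import Literature.NumberTheory.LFunctions.WeilExplicitProofs
import Literature.NumberTheory.LFunctions.WeilArchimedeanPositivity
import HarnessLib

/-!
# Weil positivity at the archimedean place: reduction to Yoshida's hermitian form

Sibling proof file of `Literature/NumberTheory/LFunctions/WeilArchimedeanPositivity.lean`
(named fact `Literature.weilPositivityOn_log_two_half = WeilPositivityOn ((log 2)/2)`), in the
normalisation of `WeilExplicit` (`ĝ(s) = ∫ g(t) e^{(s-1/2)t} dt`, `g̃(t) = conj g(-t)`,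
`Q(g) = W(g ⋆ g̃)`), which is *literally* the normalisation of

* H. Yoshida, *On Hermitian forms attached to zeta functions*, in: Zeta functions in geometry
  (Tokyo, 1990), Adv. Stud. Pure Math. **21** (1992), 281–325:
  `M(α)(s) = ∫ α(x) e^{(s-1/2)x} dx` (§1), `α̃(x) = conj α(-x)`, `F = φ * φ̃`, `F(0) = ‖φ‖₂²`,
  `F̂ = |φ̂|²` (§2), and Yoshida's hermitian form `⟨φ₁, φ₂⟩ = T(φ₁ * φ̃₂)` written through the
  explicit formula as (2.1): for `k = ℚ` (`A_ℚ = π⁻¹`, `r₁ = 1`, `r₂ = 0`) and `supp φ ⊆ [-a, a]`,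
  `⟨φ, φ⟩ = ∫ F(x)(e^{x/2} + e^{-x/2}) dx - (log π) F(0) - 2 Σ_{m log p ≤ 2a} (log p) p^{-m/2} F(m log p)
           + (1/2π) ∫ |φ̂(t)|² Re ψ(1/4 + it/2) dt`.

## What is proved here

* Support bookkeeping: `tsupport (g ⋆ g̃) ⊆ [-2a, 2a]` when `tsupport g ⊆ [-a, a]`
  (`tsupport_weilConv_weilReflect_subset`), and the prime term of `W(k)` vanishes when
  `tsupport k ⊆ [-log 2, log 2]` (`weilPrimeTerm_eq_zero_of_tsupport_subset`: no `n ≥ 2` has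
  `± log n` in the *open* support `⊆ (-log 2, log 2)`; this is the remark "the sum `Σ_p` becomes a
  finite sum", Yoshida §0, in the extreme case where it is empty).
* The three terms of `Q(g) = W(g ⋆ g̃)`: `(g ⋆ g̃)(0) = ‖g‖₂²`, `(g ⋆ g̃)^(1/2 + it) = |ĝ(1/2 + it)|²`
  (Yoshida §2: `F(0) = ‖φ‖²`, `F̂ = |φ̂|²`), polar term `= 2 Re(ĝ(0) conj ĝ(1))` (Yoshida (6.2) in
  the parity-free form).
* `weilQuadratic_eq_weilArchQuadratic`: for a test function `g` with
  `tsupport g ⊆ [-(log 2)/2, (log 2)/2]`,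
  `Q(g) = E(g) := 2 Re(ĝ(0) conj ĝ(1)) - (log π) ‖g‖₂² + (1/2π) ∫ |ĝ(1/2+it)|² Re ψ(1/4 + it/2) dt`,
  Yoshida's (2.1) for `k = ℚ`, `a = (log 2)/2` (no prime term). In particular `Q(g)` is real.
* `weilPositivityOn_log_two_half_iff`: the named fact `Literature.NumberTheory.LFunctions.weilPositivityOn_log_two_half`
  (Yoshida's Theorem 1 restricted to `C(a) = C_c^∞[-a, a]`, already vendored in
  `WeilArchimedeanPositivity.lean`; NOT re-vendored here) is equivalent to the positivity of the
  analytic form, `∀ g, IsWeilTest g → tsupport g ⊆ [-(log 2)/2, (log 2)/2] → 0 ≤ E(g)`, and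
  `weilPositivityOn_log_two_half_of_weilArchQuadratic_nonneg` is the direction a future discharge
  `weilPositivityOn_log_two_half_holds` will use; `weilPositivityOn_log_two_half.weilPositivityOn`
  transports the fact to every cone `[-a, a]`, `a ≤ (log 2)/2` (`WeilPositivityOn.mono`).
* `Yoshida1992_polar_lower_bound` (Yoshida (6.2)–(6.3), parity-free): for `tsupport g ⊆ [-a, a]`,
  `2 Re(ĝ(0) conj ĝ(1)) ≥ -2 (sinh a - a) ‖g‖₂²`; at `a = (log 2)/2`, `2(sinh a - a) = 1/√2 - log 2`,
  Yoshida's constant in (6.3).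

## What is NOT proved here

`weilPositivityOn_log_two_half` itself (i.e. `0 ≤ E(g)` on `C(a)`): Yoshida's proof (§6) is an
analytic reduction (digamma series and monotonicity of `t ↦ Re ψ(1/4 + it/2)`, the Fourier tail
bound (6.7) on `K_N(a)`, the closed forms (5.15)–(5.16) of the matrix coefficients `⟨χ_n, χ_m⟩`)
followed by two machine verifications (a `10 × 10` matrix for odd `φ`, a `200 × 200` interval
Gaussian elimination for even `φ`). It stays the named fact of `WeilArchimedeanPositivity.lean`.

## References

* H. Yoshida, *On Hermitian forms attached to zeta functions*, Adv. Stud. Pure Math. 21 (1992),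
  281–325: §§1–2, (2.1), §6 (6.1)–(6.3), Theorem 1 (p. 310).
* E. Bombieri, *Remarks on Weil's quadratic functional in the theory of prime numbers I*,
  Rend. Mat. Acc. Lincei (9) 11 (2000), 183–233, §1 (report of Yoshida's result for
  `t = (log 2)/2`).
* A. Connes, C. Consani, *Weil positivity and trace formula, the archimedean place*, Selecta
  Math. (N.S.) 27 (2021), Paper 77, Thm. 1 (a different statement: test functions with
  `ĝ(i/2) = ĝ(0) = 0`, archimedean distribution only, lower bound by a Sonin-space trace).
-/

noncomputable section

open Complex Filter Set MeasureTheory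
open scoped Real Topology Convolution ContDiff ComplexConjugate Pointwise

namespace Literature.NumberTheory.LFunctions

/-! ## Yoshida's hermitian form in analytic form -/

/-- Yoshida's hermitian form `⟨g, g⟩` for `k = ℚ` in the analytic form (2.1), for test functions
whose support is so small that no prime enters (`supp g ⊆ [-(log 2)/2, (log 2)/2]`):
`E(g) := 2 Re(ĝ(0) conj ĝ(1)) - (log π) ‖g‖₂² + (1/2π) ∫ |ĝ(1/2 + it)|² Re ψ(1/4 + it/2) dt`,
where `ĝ = weilMellin g` (`= M(g)` of Yoshida §1) and `ψ = Γ'/Γ`. Here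
`2 Re(ĝ(0) conj ĝ(1)) = ∫ F(x)(e^{x/2} + e^{-x/2}) dx` and `‖g‖₂² = F(0)`, `|ĝ(1/2+it)|² = F̂(t)`
for `F = g * g̃` (Yoshida §2 and (6.2)). It equals `Re Q(g) = Re W(g ⋆ g̃)`
(`weilQuadratic_re_eq_weilArchQuadratic`). [cite: Yoshida1992, §2 eq. (2.1) for k = ℚ] -/
def weilArchQuadratic (g : ℝ → ℂ) : ℝ :=
  2 * (weilMellin g 0 * conj (weilMellin g 1)).re - Real.log π * (∫ t : ℝ, ‖g t‖ ^ 2) +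
    1 / (2 * π) * ∫ t : ℝ, ‖weilMellin g (1 / 2 + t * I)‖ ^ 2 *
      (Complex.digamma (1 / 4 + t / 2 * I)).re

/-- Sanity check of the parse of `weilArchQuadratic` (no term is captured by an integral binder):
with `P := 2 Re(ĝ(0) conj ĝ(1))`, `N := ∫ |g|²`, `A := ∫ |ĝ(1/2+it)|² Re ψ(1/4+it/2) dt` it is
`P - (log π) N + A/(2π)`. [folklore] -/
theorem weilArchQuadratic_eq (g : ℝ → ℂ) :
    weilArchQuadratic g =
      2 * (weilMellin g 0 * conj (weilMellin g 1)).re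
        - Real.log π * (∫ t : ℝ, ‖g t‖ ^ 2)
        + 1 / (2 * π) * (∫ t : ℝ, ‖weilMellin g (1 / 2 + t * I)‖ ^ 2 *
            (Complex.digamma (1 / 4 + t / 2 * I)).re) :=
  rfl

/-! ## Support bookkeeping -/

/-- `tsupport g̃ = -tsupport g` for `g̃(t) = conj g(-t)`. [folklore] -/
theorem tsupport_weilReflect (g : ℝ → ℂ) : tsupport (weilReflect g) = -tsupport g := by
  have h : Function.support (weilReflect g) = -Function.support g := by
    ext t; simp [weilReflect]
  simp only [tsupport, h, neg_closure]

/-- `tsupport (g ⋆ h) ⊆ tsupport g + tsupport h` for compactly supported `g`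
(`support_convolution_subset` and closedness of compact + closed). [folklore] -/
theorem tsupport_weilConv_subset {g h : ℝ → ℂ} (hg : HasCompactSupport g) :
    tsupport (weilConv g h) ⊆ tsupport g + tsupport h :=
  closure_minimal
    ((support_convolution_subset (L := ContinuousLinearMap.mul ℂ ℂ) (μ := volume)).trans
      (add_subset_add (subset_tsupport g) (subset_tsupport h)))
    ((isClosed_tsupport h).add_left_of_isCompact hg.isCompact)

/-- If `supp g ⊆ [-a, a]` then `supp (g ⋆ g̃) ⊆ [-2a, 2a]` (Yoshida §2: "since
`supp F ⊆ [-2a, 2a]`" for `F = φ * φ̃`). [cite: Yoshida1992, §2] -/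
theorem tsupport_weilConv_weilReflect_subset {g : ℝ → ℂ} {a : ℝ} (hg : HasCompactSupport g)
    (h : tsupport g ⊆ Icc (-a) a) :
    tsupport (weilConv g (weilReflect g)) ⊆ Icc (-(2 * a)) (2 * a) := by
  refine (tsupport_weilConv_subset hg).trans ?_
  rw [tsupport_weilReflect]
  rintro x ⟨u, hu, v, hv, rfl⟩
  have hu' := h hu
  have hv' : -v ∈ Icc (-a) a := h (by simpa using hv)
  simp only [mem_Icc] at hu' hv' ⊢
  constructor <;> linarith

/-- A continuous function with `tsupport k ⊆ [a, b]` vanishes outside the open interval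
`(a, b)` (its support is open). [folklore] -/
theorem support_subset_Ioo_of_tsupport_subset_Icc {k : ℝ → ℂ} (hk : Continuous k) {a b : ℝ}
    (h : tsupport k ⊆ Icc a b) : Function.support k ⊆ Ioo a b := by
  rw [← interior_Icc]
  exact interior_maximal ((subset_tsupport k).trans h) hk.isOpen_support

/-- **No prime enters below `log 2`.** If `k` is continuous with `tsupport k ⊆ [-log 2, log 2]`
then the prime term `Σₙ Λ(n) n^{-1/2} (k(log n) + k(-log n))` of the explicit formula vanishes:
`Λ(0) = Λ(1) = 0`, and for `n ≥ 2`, `± log n ∉ (-log 2, log 2) ⊇ supp k` (Yoshida §0: cutting the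
support makes `Σ_p` finite — here empty). [cite: Yoshida1992, §0 and §2 eq. (2.1)] -/
theorem weilPrimeTerm_eq_zero_of_tsupport_subset {k : ℝ → ℂ} (hk : Continuous k)
    (h : tsupport k ⊆ Icc (-Real.log 2) (Real.log 2)) : weilPrimeTerm k = 0 := by
  unfold weilPrimeTerm
  refine (tsum_congr fun n ↦ ?_).trans tsum_zero
  have hsupp := support_subset_Ioo_of_tsupport_subset_Icc hk h
  rcases Nat.lt_or_ge n 2 with hn | hn
  · interval_cases n <;> simp
  · have hlog : Real.log 2 ≤ Real.log n :=
      Real.log_le_log two_pos (by exact_mod_cast hn)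
    have h1 : k (Real.log n) = 0 := by
      by_contra hne
      have := (hsupp hne).2
      linarith
    have h2 : k (-Real.log n) = 0 := by
      by_contra hne
      have := (hsupp hne).1
      linarith
    simp [h1, h2]

/-! ## The three terms of `Q(g) = W(g ⋆ g̃)` -/

/-- `(g ⋆ g̃)(0) = ∫ |g|² = ‖g‖₂²` (Yoshida §2: `F(0) = ‖φ‖²_{L²}`). [cite: Yoshida1992, §2] -/
theorem weilConv_weilReflect_apply_zero (g : ℝ → ℂ) :
    weilConv g (weilReflect g) 0 = ((∫ t : ℝ, ‖g t‖ ^ 2 : ℝ) : ℂ) := by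
  rw [weilConv_apply, ← integral_complex_ofReal]
  congr 1
  ext u
  simp only [weilReflect, zero_sub, neg_neg, Complex.mul_conj, Complex.normSq_eq_norm_sq,
    Complex.ofReal_pow]

/-- On the critical line `(g ⋆ g̃)^(1/2 + it) = |ĝ(1/2 + it)|²` (Yoshida §2: `F̂(t) = |φ̂(t)|²`). [cite: Yoshida1992, §2] -/
theorem weilMellin_weilConv_weilReflect_half {g : ℝ → ℂ} (hg : IsWeilTest g) (t : ℝ) :
    weilMellin (weilConv g (weilReflect g)) (1 / 2 + t * I) =
      ((‖weilMellin g (1 / 2 + t * I)‖ ^ 2 : ℝ) : ℂ) := by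
  rw [weilMellin_weilQuadratic_of_re_eq hg (by simp), Complex.normSq_eq_norm_sq]

/-- The polar term of `g ⋆ g̃` is `ĝ(0) conj ĝ(1) + ĝ(1) conj ĝ(0) = 2 Re(ĝ(0) conj ĝ(1))`
(Yoshida (6.2): `= 2ε |∫ φ(x) e^{x/2} dx|²` when `φ̌ = ε φ`; here without parity assumption). [cite: Yoshida1992, §6 eq. (6.2)] -/
theorem weilPolarTerm_weilConv_weilReflect {g : ℝ → ℂ} (hg : IsWeilTest g) :
    weilPolarTerm (weilConv g (weilReflect g)) =
      ((2 * (weilMellin g 0 * conj (weilMellin g 1)).re : ℝ) : ℂ) := by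
  unfold weilPolarTerm
  rw [weilMellin_weilQuadratic hg, weilMellin_weilQuadratic hg]
  simp only [map_one, sub_self, map_zero, sub_zero]
  have : weilMellin g 1 * conj (weilMellin g 0) =
      conj (weilMellin g 0 * conj (weilMellin g 1)) := by
    simp [map_mul, mul_comm]
  rw [this, Complex.add_conj]

/-- The archimedean integral of `g ⋆ g̃` is the real number `∫ |ĝ(1/2 + it)|² Re ψ(1/4 + it/2) dt`
(Yoshida (2.1), the `V₁`-term with `F̂ = |φ̂|²`). [cite: Yoshida1992, §2 eq. (2.1)] -/
theorem weilArchIntegral_weilConv_weilReflect {g : ℝ → ℂ} (hg : IsWeilTest g) :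
    weilArchIntegral (weilConv g (weilReflect g)) =
      ((∫ t : ℝ, ‖weilMellin g (1 / 2 + t * I)‖ ^ 2 *
        (Complex.digamma (1 / 4 + t / 2 * I)).re : ℝ) : ℂ) := by
  unfold weilArchIntegral
  rw [← integral_complex_ofReal]
  congr 1 with t
  rw [weilMellin_weilConv_weilReflect_half hg]
  push_cast
  ring

/-- **`Q(g)` in Yoshida's analytic form.** For a test function `g` with
`tsupport g ⊆ [-(log 2)/2, (log 2)/2]`,
`W(g ⋆ g̃) = 2 Re(ĝ(0) conj ĝ(1)) - (log π) ‖g‖₂² + (1/2π) ∫ |ĝ(1/2 + it)|² Re ψ(1/4 + it/2) dt`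
(as a complex number with zero imaginary part): the prime term vanishes
(`weilPrimeTerm_eq_zero_of_tsupport_subset`) and the polar and archimedean terms are as in
Yoshida (2.1)/(6.2). [cite: Yoshida1992, §2 eq. (2.1) and §6 eq. (6.2), k = ℚ, a = (log 2)/2] -/
theorem weilQuadratic_eq_weilArchQuadratic {g : ℝ → ℂ} (hg : IsWeilTest g)
    (hsupp : tsupport g ⊆ Icc (-(Real.log 2 / 2)) (Real.log 2 / 2)) :
    weilQuadratic g = (weilArchQuadratic g : ℂ) := by
  have hk : IsWeilTest (weilConv g (weilReflect g)) := hg.weilConv hg.weilReflect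
  have hks : tsupport (weilConv g (weilReflect g)) ⊆ Icc (-Real.log 2) (Real.log 2) := by
    have h := tsupport_weilConv_weilReflect_subset (a := Real.log 2 / 2) hg.2 hsupp
    convert h using 2 <;> ring
  unfold weilQuadratic weilFunctional weilArchTerm weilArchQuadratic
  rw [weilPrimeTerm_eq_zero_of_tsupport_subset hk.1.continuous hks,
    weilPolarTerm_weilConv_weilReflect hg, weilArchIntegral_weilConv_weilReflect hg,
    weilConv_weilReflect_apply_zero]
  push_cast
  ring

/-- Real part version: `Re Q(g) = E(g)` (Yoshida (2.1)) for `tsupport g ⊆ [-(log 2)/2, (log 2)/2]`. [cite: Yoshida1992, §2 eq. (2.1), k = ℚ, a = (log 2)/2] -/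
theorem weilQuadratic_re_eq_weilArchQuadratic {g : ℝ → ℂ} (hg : IsWeilTest g)
    (hsupp : tsupport g ⊆ Icc (-(Real.log 2 / 2)) (Real.log 2 / 2)) :
    (weilQuadratic g).re = weilArchQuadratic g := by
  rw [weilQuadratic_eq_weilArchQuadratic hg hsupp, Complex.ofReal_re]

/-- For `tsupport g ⊆ [-(log 2)/2, (log 2)/2]` the quadratic functional is real:
`Im Q(g) = 0` (the case of the named fact `Literature.NumberTheory.LFunctions.weilQuadratic_im` in which no prime enters). [cite: Yoshida1992, §2 (⟨ , ⟩ is hermitian)] -/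
theorem weilQuadratic_im_eq_zero_of_tsupport_subset {g : ℝ → ℂ} (hg : IsWeilTest g)
    (hsupp : tsupport g ⊆ Icc (-(Real.log 2 / 2)) (Real.log 2 / 2)) :
    (weilQuadratic g).im = 0 := by
  rw [weilQuadratic_eq_weilArchQuadratic hg hsupp, Complex.ofReal_im]

/-! ## The named fact `weilPositivityOn_log_two_half` in analytic form -/

/-- **Reduction.** `Literature.NumberTheory.LFunctions.weilPositivityOn_log_two_half` (Weil positivity for
`tsupport g ⊆ [-(log 2)/2, (log 2)/2]`, Yoshida's Theorem 1 restricted to `C(a)`) is equivalent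
to the non-negativity of Yoshida's analytic form (2.1) on `C(a)`:
`∀ g, IsWeilTest g → tsupport g ⊆ [-(log 2)/2, (log 2)/2] → 0 ≤ E(g)`. [cite: Yoshida1992, Thm 1 (§6 p. 310) with eq. (2.1)] -/
theorem weilPositivityOn_log_two_half_iff :
    weilPositivityOn_log_two_half ↔
      ∀ g : ℝ → ℂ, IsWeilTest g → tsupport g ⊆ Icc (-(Real.log 2 / 2)) (Real.log 2 / 2) →
        0 ≤ weilArchQuadratic g := by
  unfold weilPositivityOn_log_two_half WeilPositivityOn
  refine forall₃_congr fun g hg hsupp ↦ ?_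
  rw [weilQuadratic_re_eq_weilArchQuadratic hg hsupp]

/-- The direction used by a discharge: non-negativity of Yoshida's analytic form (2.1) on
`C(a)`, `a = (log 2)/2`, implies the named fact `Literature.NumberTheory.LFunctions.weilPositivityOn_log_two_half`. [cite: Yoshida1992, Thm 1 (§6 p. 310) with eq. (2.1)] -/
theorem weilPositivityOn_log_two_half_of_weilArchQuadratic_nonneg
    (h : ∀ g : ℝ → ℂ, IsWeilTest g → tsupport g ⊆ Icc (-(Real.log 2 / 2)) (Real.log 2 / 2) →
      0 ≤ weilArchQuadratic g) :
    weilPositivityOn_log_two_half :=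
  weilPositivityOn_log_two_half_iff.2 h

/-- Monotonicity of the truncated cones: `WeilPositivityOn b → WeilPositivityOn a` for `a ≤ b`
(`K_a ⊆ K_b`; Yoshida §8: "`C(u) ⊆ C(v)` if `u ≤ v`"). [cite: Yoshida1992, §8] -/
theorem WeilPositivityOn.mono {a b : ℝ} (hab : a ≤ b) (h : WeilPositivityOn b) :
    WeilPositivityOn a :=
  fun g hg hsupp ↦ h g hg (hsupp.trans (Icc_subset_Icc (neg_le_neg hab) hab))

/-- Hence the named fact gives Weil positivity on every cone `[-a, a]` with `a ≤ (log 2)/2`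
(Yoshida, Thm 1 and §0: "positive definite for `a ≤ log 2/2`"). [cite: Yoshida1992, Thm 1 and §0] -/
theorem weilPositivityOn_log_two_half.weilPositivityOn (h : weilPositivityOn_log_two_half)
    {a : ℝ} (ha : a ≤ Real.log 2 / 2) : WeilPositivityOn a :=
  WeilPositivityOn.mono ha h

/-! ## The polar term is almost non-negative (Yoshida (6.2)–(6.3)) -/

/-- `∫_{-a}^{a} sinh²(x/2) dx = sinh a - a` for `a ≥ 0` (the primitive of `sinh²(x/2) = (cosh x - 1)/2`
is `(sinh x - x)/2`). At `a = (log 2)/2` this is `(1/√2 - log 2)/2`, half of Yoshida's constant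
in (6.3). [folklore] -/
theorem integral_Icc_sinh_half_sq {a : ℝ} (ha : 0 ≤ a) :
    ∫ x in Icc (-a) a, Real.sinh (x / 2) ^ 2 = Real.sinh a - a := by
  rw [integral_Icc_eq_integral_Ioc, ← intervalIntegral.integral_of_le (by linarith)]
  have hderiv : ∀ x ∈ uIcc (-a) a,
      HasDerivAt (fun x ↦ (Real.sinh x - x) / 2) (Real.sinh (x / 2) ^ 2) x := by
    intro x _
    have h1 : HasDerivAt (fun x ↦ (Real.sinh x - x) / 2) ((Real.cosh x - 1) / 2) x :=
      ((Real.hasDerivAt_sinh x).sub (hasDerivAt_id x)).div_const 2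
    convert h1 using 1
    have h2 := Real.cosh_add (x / 2) (x / 2)
    rw [add_halves] at h2
    nlinarith [Real.cosh_sq (x / 2)]
  rw [intervalIntegral.integral_eq_sub_of_hasDerivAt hderiv
    ((by fun_prop : Continuous fun x ↦ Real.sinh (x / 2) ^ 2).intervalIntegrable _ _)]
  simp only [Real.sinh_neg]
  ring

/-- `sinh ((log 2)/2) = 1/(2√2)` … in the form used below: `2 (sinh((log 2)/2) - (log 2)/2) =
1/√2 - log 2`, Yoshida's constant in (6.3) (`e^{(log 2)/2} = √2`). [cite: Yoshida1992, §6 eq. (6.3)] -/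
theorem two_mul_sinh_log_two_half_sub :
    2 * (Real.sinh (Real.log 2 / 2) - Real.log 2 / 2) = 1 / Real.sqrt 2 - Real.log 2 := by
  have h2 : Real.exp (Real.log 2 / 2) = Real.sqrt 2 := by
    rw [Real.sqrt_eq_rpow, Real.rpow_def_of_pos two_pos]
    ring_nf
  have hs : Real.sqrt 2 ≠ 0 := by positivity
  rw [Real.sinh_eq, Real.exp_neg, h2]
  have hsq : Real.sqrt 2 * Real.sqrt 2 = 2 := Real.mul_self_sqrt zero_le_two
  field_simp
  nlinarith [hsq]

/-- **Yoshida (6.2)–(6.3), parity-free form.** For a test function `g` with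
`tsupport g ⊆ [-a, a]`, the polar term satisfies
`2 Re(ĝ(0) conj ĝ(1)) ≥ -2 (sinh a - a) ‖g‖₂²`.
Proof: with `c = ∫ g(x) cosh(x/2) dx`, `s = ∫ g(x) sinh(x/2) dx` one has `ĝ(1) = c + s`,
`ĝ(0) = c - s`, so `2 Re(ĝ(0) conj ĝ(1)) = 2|c|² - 2|s|² ≥ -2|s|²`, and by Cauchy–Schwarz
`|s|² ≤ ‖g‖₂² ∫_{-a}^{a} sinh²(x/2) dx = (sinh a - a) ‖g‖₂²`. (Yoshida (6.2): for `φ̌ = εφ` the polar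
term is `2ε|∫ φ e^{x/2}|²`, and (6.3) bounds it below by `-(1/√2 - log 2)‖φ‖²` at `a = (log 2)/2`;
the present statement needs no parity.) [cite: Yoshida1992, §6 eqs. (6.2)–(6.3)] -/
theorem Yoshida1992_polar_lower_bound {g : ℝ → ℂ} (hg : IsWeilTest g) {a : ℝ}
    (hsupp : tsupport g ⊆ Icc (-a) a) :
    -(2 * (Real.sinh a - a)) * ∫ t : ℝ, ‖g t‖ ^ 2 ≤
      2 * (weilMellin g 0 * conj (weilMellin g 1)).re := by
  rcases lt_or_ge a 0 with ha | ha
  · -- empty cone: `g = 0`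
    have hg0 : g = 0 := by
      rw [← tsupport_eq_empty_iff]
      exact eq_empty_of_subset_empty (hsupp.trans (by rw [Icc_eq_empty (by linarith)]))
    subst hg0
    simp [weilMellin]
  -- integrability of `g · φ` for continuous real `φ`
  have hgi : ∀ φ : ℝ → ℝ, Continuous φ → Integrable fun x ↦ g x * (φ x : ℂ) := fun φ hφ ↦
    (hg.1.continuous.mul (continuous_ofReal.comp hφ)).integrable_of_hasCompactSupport
      hg.2.mul_right
  set c : ℂ := ∫ x : ℝ, g x * (Real.cosh (x / 2) : ℂ) with hc
  set s : ℂ := ∫ x : ℝ, g x * (Real.sinh (x / 2) : ℂ) with hs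
  have h1 : weilMellin g 1 = c + s := by
    unfold weilMellin
    rw [hc, hs, ← integral_add (hgi _ (by fun_prop)) (hgi _ (by fun_prop))]
    congr 1 with x
    have : cexp ((1 - 1 / 2) * (x : ℂ)) = (Real.cosh (x / 2) : ℂ) + (Real.sinh (x / 2) : ℂ) := by
      rw [← Complex.ofReal_add, Real.cosh_add_sinh, Complex.ofReal_exp]
      congr 1
      push_cast
      ring
    rw [this]
    ring
  have h0 : weilMellin g 0 = c - s := by
    unfold weilMellin
    rw [hc, hs, ← integral_sub (hgi _ (by fun_prop)) (hgi _ (by fun_prop))]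
    congr 1 with x
    have : cexp ((0 - 1 / 2) * (x : ℂ)) = (Real.cosh (x / 2) : ℂ) - (Real.sinh (x / 2) : ℂ) := by
      rw [← Complex.ofReal_sub, Real.cosh_sub_sinh, Complex.ofReal_exp]
      congr 1
      push_cast
      ring
    rw [this]
    ring
  have hre : (weilMellin g 0 * conj (weilMellin g 1)).re = ‖c‖ ^ 2 - ‖s‖ ^ 2 := by
    rw [h0, h1, ← Complex.normSq_eq_norm_sq, ← Complex.normSq_eq_norm_sq, Complex.normSq_apply,
      Complex.normSq_apply]
    simp only [mul_re, sub_re, sub_im, map_add, add_re, add_im, conj_re, conj_im]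
    ring
  -- Cauchy–Schwarz for `s`
  have hs_bound : ‖s‖ ^ 2 ≤ (Real.sinh a - a) * ∫ t : ℝ, ‖g t‖ ^ 2 := by
    have hzero : ∀ x, x ∉ Icc (-a) a → g x = 0 := fun x hx ↦
      image_eq_zero_of_notMem_tsupport fun h ↦ hx (hsupp h)
    -- restrict both integrals to `[-a, a]`
    have hsI : s = ∫ x in Icc (-a) a, g x * (Real.sinh (x / 2) : ℂ) := by
      rw [hs, setIntegral_eq_integral_of_forall_compl_eq_zero]
      intro x hx
      simp [hzero x hx]
    have hNI : ∫ t : ℝ, ‖g t‖ ^ 2 = ∫ t in Icc (-a) a, ‖g t‖ ^ 2 := by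
      rw [setIntegral_eq_integral_of_forall_compl_eq_zero]
      intro x hx
      simp [hzero x hx]
    -- `‖s‖ ≤ ∫_{[-a,a]} ‖g‖ |sinh(x/2)|`
    have hle : ‖s‖ ≤ ∫ x in Icc (-a) a, ‖g x‖ * |Real.sinh (x / 2)| := by
      rw [hsI]
      refine (norm_integral_le_integral_norm _).trans (le_of_eq ?_)
      congr 1 with x
      rw [norm_mul, Complex.norm_real, Real.norm_eq_abs]
    -- Cauchy–Schwarz on the finite measure `volume.restrict [-a, a]`
    have hf2 : MemLp (fun x ↦ ‖g x‖) (ENNReal.ofReal 2) (volume.restrict (Icc (-a) a)) := by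
      rw [ENNReal.ofReal_ofNat, memLp_two_iff_integrable_sq
        (hg.1.continuous.norm.aestronglyMeasurable)]
      exact ((hg.1.continuous.norm.pow 2).integrableOn_Icc)
    have hk2 : MemLp (fun x ↦ |Real.sinh (x / 2)|) (ENNReal.ofReal 2)
        (volume.restrict (Icc (-a) a)) := by
      have hk : Continuous fun x ↦ |Real.sinh (x / 2)| := by fun_prop
      rw [ENNReal.ofReal_ofNat, memLp_two_iff_integrable_sq hk.aestronglyMeasurable]
      exact (hk.pow 2).integrableOn_Icc
    have hCS := integral_mul_le_Lp_mul_Lq_of_nonneg Real.HolderConjugate.two_two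
      (Eventually.of_forall fun x ↦ norm_nonneg (g x))
      (Eventually.of_forall fun x ↦ abs_nonneg (Real.sinh (x / 2))) hf2 hk2
    simp only [Real.rpow_two, sq_abs] at hCS
    rw [integral_Icc_sinh_half_sq ha] at hCS
    have hA : 0 ≤ ∫ x in Icc (-a) a, ‖g x‖ ^ 2 := integral_nonneg fun x ↦ by positivity
    have hB : 0 ≤ Real.sinh a - a := sub_nonneg.2 (Real.self_le_sinh_iff.2 ha)
    have hprod : ((∫ x in Icc (-a) a, ‖g x‖ ^ 2) ^ (1 / 2 : ℝ) *
        (Real.sinh a - a) ^ (1 / 2 : ℝ)) ^ 2 =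
        (∫ x in Icc (-a) a, ‖g x‖ ^ 2) * (Real.sinh a - a) := by
      rw [mul_pow, ← Real.rpow_natCast, ← Real.rpow_natCast, ← Real.rpow_mul hA,
        ← Real.rpow_mul hB]
      norm_num
    calc ‖s‖ ^ 2 ≤ (∫ x in Icc (-a) a, ‖g x‖ * |Real.sinh (x / 2)|) ^ 2 :=
          pow_le_pow_left₀ (norm_nonneg _) hle 2
      _ ≤ ((∫ x in Icc (-a) a, ‖g x‖ ^ 2) ^ (1 / 2 : ℝ) * (Real.sinh a - a) ^ (1 / 2 : ℝ)) ^ 2 :=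
          pow_le_pow_left₀ (integral_nonneg fun x ↦ by positivity) hCS 2
      _ = (Real.sinh a - a) * ∫ t : ℝ, ‖g t‖ ^ 2 := by rw [hprod, hNI, mul_comm]
  rw [hre]
  nlinarith [sq_nonneg ‖c‖, hs_bound]

/-- Yoshida's (6.3) at `a = (log 2)/2`, parity-free: for a test function `g` with
`tsupport g ⊆ [-(log 2)/2, (log 2)/2]`,
`E(g) ≥ -(log π) ‖g‖₂² - (1/√2 - log 2) ‖g‖₂² + (1/2π) ∫ |ĝ(1/2+it)|² Re ψ(1/4 + it/2) dt`
(Yoshida states it for `‖φ‖ = 1` and `φ̌ = ±φ`). [cite: Yoshida1992, §6 eq. (6.3)] -/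
theorem Yoshida1992_eq_6_3 {g : ℝ → ℂ} (hg : IsWeilTest g)
    (hsupp : tsupport g ⊆ Icc (-(Real.log 2 / 2)) (Real.log 2 / 2)) :
    -(Real.log π) * (∫ t : ℝ, ‖g t‖ ^ 2) - (1 / Real.sqrt 2 - Real.log 2) * (∫ t : ℝ, ‖g t‖ ^ 2)
        + 1 / (2 * π) * (∫ t : ℝ, ‖weilMellin g (1 / 2 + t * I)‖ ^ 2 *
            (Complex.digamma (1 / 4 + t / 2 * I)).re) ≤
      weilArchQuadratic g := by
  have h := Yoshida1992_polar_lower_bound hg hsupp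
  rw [two_mul_sinh_log_two_half_sub] at h
  rw [weilArchQuadratic_eq]
  linarith

end Literature.NumberTheory.LFunctions

end
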